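import Summits.AtomisticToContinuum.FouriersLaw.Theorems.LatticeLandauDampingAbelThermodynamicLimitWitnessTightOfUniformEnergyBound

/-!
# Witness tightness (WT) of line `loomis-compact-horizon-witness`, reduced to
# "SPATIALLY DECAYING ANCHORED CORRELATIONS FORCE TIGHTNESS", with the linearised stretched-state calibration
(crux `EmbeddedDrudeMourre.AbelThermodynamicLimit`, item stmt-AtomisticToContinuum-12596, twin stmt-14013;
`--supports` helper file, closes nothing; proves the registered reduction stub
`stub_witnessTightOfAnchoredDecayTight`)

(WT) = registered `stub_witnessTight`: for `P = pinnedChain ω₂ lam β γ` (all `> 0`) and `T > 0` the DLR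
state `μ` of every Abelian Green–Kubo witness `(μ, D, κ)` at `T` is one-site tight uniformly in the site,
`∀ ε > 0 ∃ R ∀ x, μ {R < |q_x|} ≤ ε`.

## What is proved here (all proofs complete, no named fact, no `sorry`)

* §1 `tendsto_anchoredCorrelation_cofinite` (/`_atTop`/`_atBot`): the witness clause
  `D.HasAbsConvergentCorrelation μ t` forces the ANCHORED correlations `x ↦ ∫ j_0 · (j_x ∘ φ_t) dμ` to tend
  to `0` as `|x| → ∞`; contrapositive `not_hasAbsConvergentCorrelation_of_not_tendsto` (the negative-side
  form: termwise non-decay at ONE time refutes the witness clause at that time).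
* §2 `stub_witnessTightOfAnchoredDecayTight` (registered on stmt-12596): (WT) follows from
  (AD⇒T) `stub_anchoredDecayTight` (registered, OPEN): a DLR state of `P` at `T` preserved by an
  `InfiniteChainDynamics` whose anchored current correlations are integrable and tend to `0` as
  `|x| → ∞` AT EVERY TIME is one-site tight. The Abel clause, `0 < κ` and the summability half of
  `HasAbsConvergentCorrelation` are not needed by the mechanism below; (AD⇒T) is formally stronger than
  the sibling's (DT) (hypothesis of `stub_witnessRegularisationOfDynamicalTightness`), which sits between
  (AD⇒T) and (WT).
* §3 the kernel-checked arithmetic of the calibration (`stretched_ratio_balance`,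
  `stretchedTransfer_charpoly_eq`): along a stretched equilibrium of ratio `ρ > 1` the linearised static
  transfer recursion has characteristic polynomial `ρ²y² - (ρ² + 1 + η)y + 1 = ρ²(y - ρ)(y - ρ⁻³)`,
  `η = lim U''(m_x)/V''(m_x - m_{x-1}) = ρ²(ρ-1)(1-ρ⁻³)`: growing solution `ρ^x` (the tangent `∂_c m`
  of the equilibrium family), decaying solution `ρ^{-3x}` — EXACTLY the reciprocal of the growth `ρ^{3x}`
  of the static bond force `V'(m_{x+1} - m_x)`.

## Diagnosis (worker of stub `stub_witnessTight`, 2026-08-16; nothing below is used in a proof)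

(WT) is not decidable from the tree; this wave makes the dynamical mechanism quantitative and corrects
the conjectured one.

1. **Infinitesimal invariance is DLR.** The tree proves `∫ 𝒜f dμ = 0` for every DLR state, every
   local `C¹` test function with `𝒜f ∈ L¹(μ)` and every chain with `C²` potentials and B1
   (`OscillatorChain.IsChainGibbsMeasure.integral_liouvilleZ_eq_zero`, `InfiniteChainGibbsStationarity`;
   B1, `C²` hold for `pinnedChain`). Hence the virial identity (`f = q_x p_x` truncated) and the local
   energy balance (`f = h_x`) hold in EVERY DLR state, stretched ones included: `PreservesMeasure`
   carries information beyond DLR only globally in time, none of it through generator identities.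
2. **The tree's uniqueness/blow-up files do not touch stretched profiles.**
   `InfiniteChainDynamicsBlowup` is the failure of B1 for a concave pinning (severed blow-up
   `q = 1/(1-t)`); `InfiniteChainUniqueness(Proofs)` is LLL 1977 Thms 2/4, uniqueness in the POLYNOMIAL
   growth class `|q_j(t)| ≤ C(|j|^{1/m} + 1)` from the moment condition (18) — silent on geometric
   profiles `m_x ~ c ρ^{|x|}`.
3. **Linearised stretched state (the calibration; numerics by this worker, pure arithmetic, 70 digits).**
   Symmetric stretched equilibria exist for every centre value: `U'(m_0) = 2V'(m_1 - m_0)`, then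
   `V'(Δm_{x+1}) = V'(Δm_x) + U'(m_x)` forward; `m_{x+1}/m_x → ρ` with `lam/β = (ρ-1)³(1-ρ⁻³)`
   (`ρ = 2.0425` at `lam = β`; `2.6180` at `lam/β = 4`; `1.6374` at `lam/β = 0.2`). Linearising,
   `ξ̈_x = -u_x ξ_x + k_{x+1}(ξ_{x+1} - ξ_x) - k_x(ξ_x - ξ_{x-1})`, `k_x = V''(Δm_x) ~ 3β Δm_x²`,
   `u_x = U''(m_x) ~ 3 lam m_x²`, both `∝ ρ^{2|x|}`, `u_x/k_x → η` (`= 3.8386` at `lam = β`, predicted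
   `ρ²(ρ-1)(1-ρ⁻³) = 3.8386`). Consequences (`ω₂ = lam = β = T = 1`, `m_0 = 3.46`, box `[-8, 8]`):
   (i) by §3 the solutions of the static recursion grow like `ρ^x` / decay like `ρ^{-3x}` (numerical
   ratios `2.0425` and `0.11734`, `ρ⁻³ = 0.11736`); `ρ^x ∉ ℓ²`, so the Jacobi operator `A` is LIMIT
   POINT at `±∞`: the finite-energy linearised dynamics is UNIQUE (reflecting at the infinitely heavy
   ends), although the acoustic travel time `Σ_x k_x^{-1/2} = 0.771` over the box (`0.386` per side) is
   finite — the conjectured mechanism (a) (non-uniqueness by influx from infinity) is NOT what the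
   linearisation shows; (ii) `u_x → ∞` gives `A` compact resolvent: PURE POINT spectrum, one mode
   localised per site, frequencies `8.75, 15.53, 15.73, 32.31, 32.32, 66.00, 66.00, 134.77, 134.77,
   275.26, …` (ratio `→ ρ` per site, a Wannier–Stark-type ladder), every eigenvector decaying like
   `ρ^{-3|x|}` (lowest mode: successive ratios `0.1364, 0.1262, 0.1197, 0.1179, 0.1175, 0.1174`);
   (iii) the static bond force `f_x = V'(Δm_x) = 22.4, 263, 2.24e3, 1.90e4, 1.61e5, 1.37e6, …`
   (`× ρ³ = 8.52` per site), so `e_0(x)·f_x → const` (`1.000, 1.074, 1.090, 1.094, 1.095, 1.095`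
   relative to `x = 1`) and the leading Gaussian/linear anchored correlation
   `⟨j_0(0) j_x(t)⟩ ≈ (T/4) f_0 f_x [P_{x,0} + P_{x,1} + P_{x+1,0} + P_{x+1,1}](t)`, `P = cos(t√A)`,
   tends to a NON-ZERO `x`-independent almost-periodic `g(t)`: `x = 0..6` at `t = 1`:
   `-212, -1698, -3332, -4294, -4539, -4598, -4609`; at `t = 0.2`: `-117, -1629, -3862, -4136, -4173,
   -4180, -4179`; at `t = 0.05`: `208, 1233, 1558, 1157, 1000, 958, 947`; at `t = 0` exactly `0` for
   `x ≥ 2` (momenta i.i.d.). Same at `(lam, β) = (1, 0.25)`, `m_0 = 3`: `g(1) = -1330`; `(0.2, 1)`,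
   `m_0 = 3`: `g(1) = 62.9`.
   So in the linearised toy a stretched state violates `HasAbsConvergentCorrelation μ t` at every `t`
   with `g(t) ≠ 0` by TERMWISE NON-DECAY, and the balance is borderline-exact and `ρ`-independent:
   response decay `ρ^{-3|x|}` (rigid quasi-static response of the stiff far region to the slow core,
   NOT a light-cone effect) against force growth `ρ^{3|x|}` (§3). (iv) Abel side: pure point spectrum
   makes every linearised correlation almost periodic; an even almost-periodic
   `C(t) = Σ a_n cos(ω_n t)`, `Σ|a_n| < ∞`, has Abel functional `∫₀^∞ e^{-νt}C = a_0/ν + Σ_{ω_n≠0}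
   a_n ν/(ν² + ω_n²)`: divergent if the Bohr mean `a_0 ≠ 0` (Drude floor, `not_tendsto_of_drude_floor`),
   tending to `0` if `a_0 = 0` and `Σ_{ω_n≠0} |a_n|/|ω_n| < ∞` — never to `T²κ > 0`: a second,
   spectral obstruction in the toy.
4. **Residual, typed:** (AD⇒T) `stub_anchoredDecayTight` (§2). A proof needs two paper-level facts not
   in print for this chain: (S) the static dichotomy "a DLR state of `pinnedChain` at `T` is one-site
   tight or charges configurations following a stretched profile `|q_x| ≥ c ρ^{|x|}` on a half-line"
   (boundary-law / Martin-boundary classification of the 1-D Markov specification; Gaussian case: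
   Kesten–Spitzer), and (F) the far-field response of the TRUE dynamics along such configurations
   (item 3(iii) with linearisation error `O(ρ^{-2|x|})` relative). At the harmonic corner
   `lam = β = 0` (outside the stub) (AD⇒T) FAILS (constant stiffness, genuine light cone, summable
   correlations of the translated Gaussian states — twin file's note) while (WT) survives through the
   Abel clause: any proof of (AD⇒T) uses `β > 0`.
-/

noncomputable section

namespace Summit.AtomisticToContinuum.FouriersLaw.Theorems.AbelThermodynamicLimit.LoomisCompactHorizonWitness

open MeasureTheory Filter Set
open scoped ENNReal Topology
open Literature.MathematicalPhysics.KineticTheory.HeatConduction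

/-! ## §1 Absolutely convergent anchored correlations decay along the lattice -/

/-- **Summable anchored correlations tend to zero.** If `Σ_x |∫ j_0 (j_x ∘ φ_t) dμ| < ∞`
(`HasAbsConvergentCorrelation μ t`), then `∫ j_0 (j_x ∘ φ_t) dμ → 0` as `|x| → ∞` (cofinite filter on
`ℤ`). [folklore] -/
theorem tendsto_anchoredCorrelation_cofinite {P : OscillatorChain} (D : InfiniteChainDynamics P)
    {μ : Measure ChainConfig} {t : ℝ} (h : D.HasAbsConvergentCorrelation μ t) :
    Tendsto (fun x : ℤ => ∫ σ, P.bondCurrentZ σ 0 * P.bondCurrentZ (D.flow t σ) x ∂μ)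
      cofinite (𝓝 0) :=
  (summable_abs_iff.1 h.2).tendsto_cofinite_zero

/-- The same decay towards `+∞`. [folklore] -/
theorem tendsto_anchoredCorrelation_atTop {P : OscillatorChain} (D : InfiniteChainDynamics P)
    {μ : Measure ChainConfig} {t : ℝ} (h : D.HasAbsConvergentCorrelation μ t) :
    Tendsto (fun x : ℤ => ∫ σ, P.bondCurrentZ σ 0 * P.bondCurrentZ (D.flow t σ) x ∂μ)
      atTop (𝓝 0) :=
  (tendsto_anchoredCorrelation_cofinite D h).mono_left atTop_le_cofinite

/-- The same decay towards `-∞`. [folklore] -/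
theorem tendsto_anchoredCorrelation_atBot {P : OscillatorChain} (D : InfiniteChainDynamics P)
    {μ : Measure ChainConfig} {t : ℝ} (h : D.HasAbsConvergentCorrelation μ t) :
    Tendsto (fun x : ℤ => ∫ σ, P.bondCurrentZ σ 0 * P.bondCurrentZ (D.flow t σ) x ∂μ)
      atBot (𝓝 0) :=
  (tendsto_anchoredCorrelation_cofinite D h).mono_left (by rw [Int.cofinite_eq]; exact le_sup_left)

/-- **Negative-side form**: termwise NON-decay of the anchored correlations at one time `t` refutes
the witness clause `HasAbsConvergentCorrelation μ t` (the form in which the linearised stretched state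
fails it, module docstring item 3(iii)). [folklore] -/
theorem not_hasAbsConvergentCorrelation_of_not_tendsto {P : OscillatorChain}
    (D : InfiniteChainDynamics P) {μ : Measure ChainConfig} {t : ℝ}
    (h : ¬ Tendsto (fun x : ℤ => ∫ σ, P.bondCurrentZ σ 0 * P.bondCurrentZ (D.flow t σ) x ∂μ)
      cofinite (𝓝 0)) :
    ¬ D.HasAbsConvergentCorrelation μ t :=
  fun hAC => h (tendsto_anchoredCorrelation_cofinite D hAC)

/-! ## §2 The registered reduction: (WT) from (AD⇒T) -/

/-- **`stub_witnessTightOfAnchoredDecayTight`** (registered on stmt-AtomisticToContinuum-12596; reduction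
of `stub_witnessTight`, line `loomis-compact-horizon-witness`). For `P = pinnedChain ω₂ lam β γ`
(all `> 0`) and `T > 0`: IF (AD⇒T) every DLR state of `P` at `T` preserved by an `InfiniteChainDynamics`
whose anchored current correlations `x ↦ ∫ j_0 (j_x ∘ φ_t) dμ` are integrable and tend to `0` as
`|x| → ∞` at every time `t` is one-site tight, THEN (WT): the state of every Abelian Green–Kubo witness
at `T` is one-site tight — the witness clause `∀ t, HasAbsConvergentCorrelation μ t` supplies
integrability and (§1) the decay; `0 < κ` and the Abel limit are not used. [folklore] -/
theorem stub_witnessTightOfAnchoredDecayTight :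
    ∀ ω₂ lam β γ : ℝ, 0 < ω₂ → 0 < lam → 0 < β → 0 < γ →
      ∀ T : ℝ, 0 < T →
        (∀ (μ : MeasureTheory.Measure
                Literature.MathematicalPhysics.KineticTheory.HeatConduction.ChainConfig)
            (D : Literature.MathematicalPhysics.KineticTheory.HeatConduction.InfiniteChainDynamics
              (Literature.MathematicalPhysics.KineticTheory.HeatConduction.pinnedChain ω₂ lam β γ)),
            (Literature.MathematicalPhysics.KineticTheory.HeatConduction.pinnedChain
                ω₂ lam β γ).IsChainGibbsMeasure T μ → D.PreservesMeasure μ →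
            (∀ (t : ℝ) (x : ℤ), MeasureTheory.Integrable
              (fun σ : Literature.MathematicalPhysics.KineticTheory.HeatConduction.ChainConfig =>
                (Literature.MathematicalPhysics.KineticTheory.HeatConduction.pinnedChain
                    ω₂ lam β γ).bondCurrentZ σ 0 *
                  (Literature.MathematicalPhysics.KineticTheory.HeatConduction.pinnedChain
                    ω₂ lam β γ).bondCurrentZ (D.flow t σ) x) μ) →
            (∀ t : ℝ, Filter.Tendsto (fun x : ℤ => MeasureTheory.integral μ
              (fun σ : Literature.MathematicalPhysics.KineticTheory.HeatConduction.ChainConfig =>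
                (Literature.MathematicalPhysics.KineticTheory.HeatConduction.pinnedChain
                    ω₂ lam β γ).bondCurrentZ σ 0 *
                  (Literature.MathematicalPhysics.KineticTheory.HeatConduction.pinnedChain
                    ω₂ lam β γ).bondCurrentZ (D.flow t σ) x))
              Filter.cofinite (nhds 0)) →
            ∀ ε : ℝ, 0 < ε → ∃ R : ℝ, ∀ x : ℤ,
              μ {σ : Literature.MathematicalPhysics.KineticTheory.HeatConduction.ChainConfig |
                  R < |(σ x).1|} ≤ ENNReal.ofReal ε) →
        ∀ (μ : MeasureTheory.Measure
                Literature.MathematicalPhysics.KineticTheory.HeatConduction.ChainConfig)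
            (D : Literature.MathematicalPhysics.KineticTheory.HeatConduction.InfiniteChainDynamics
              (Literature.MathematicalPhysics.KineticTheory.HeatConduction.pinnedChain ω₂ lam β γ))
            (κ : ℝ),
            (Literature.MathematicalPhysics.KineticTheory.HeatConduction.pinnedChain
                ω₂ lam β γ).IsChainGibbsMeasure T μ → D.PreservesMeasure μ →
            (∀ t : ℝ, D.HasAbsConvergentCorrelation μ t) → 0 < κ →
            Filter.Tendsto (fun ν : ℝ => (T ^ 2)⁻¹ *
              MeasureTheory.integral (MeasureTheory.volume.restrict (Set.Ioi (0:ℝ)))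
                (fun t : ℝ => Real.exp (-(ν * t)) * D.currentCorrelation μ t))
              (nhdsWithin (0:ℝ) (Set.Ioi 0)) (nhds κ) →
            ∀ ε : ℝ, 0 < ε → ∃ R : ℝ, ∀ x : ℤ,
              μ {σ : Literature.MathematicalPhysics.KineticTheory.HeatConduction.ChainConfig |
                  R < |(σ x).1|} ≤ ENNReal.ofReal ε := by
  intro ω₂ lam β γ _hω _hl _hβ _hγ T _hT hAD μ D _κ hG hP hAC _hκ _hlim
  exact hAD μ D hG hP (fun t x => (hAC t).1 x) (fun t => tendsto_anchoredCorrelation_cofinite D (hAC t))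

/-! ## §3 Calibration arithmetic of the linearised stretched state -/

/-- **Ratio equation of a stretched equilibrium.** Leading-order balance of
`U'(m_x) = V'(m_{x+1} - m_x) - V'(m_x - m_{x-1})` along `m_x = c ρ^x` with cubic `U' ~ lam m³`,
`V' ~ β r³`: `lam = β[(ρ-1)³ - (1-ρ⁻¹)³] = β (ρ-1)³ (1-ρ⁻³)`. [folklore] -/
theorem stretched_ratio_balance (ρ : ℝ) (hρ : ρ ≠ 0) :
    (ρ - 1) ^ 3 - (1 - ρ⁻¹) ^ 3 = (ρ - 1) ^ 3 * (1 - ρ⁻¹ ^ 3) := by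
  field_simp

/-- **The linearised static transfer recursion factorises at `ρ` and `ρ⁻³`.** With
`η = lim U''(m_x)/V''(m_x - m_{x-1}) = (lam/β) ρ²/(ρ-1)² = ρ²(ρ-1)(1-ρ⁻³)`, the characteristic
polynomial `ρ²y² - (ρ² + 1 + η)y + 1` of the asymptotic ratio `y = lim e_{x+1}/e_x` of solutions of
`k_{x+1}(e_{x+1} - e_x) = k_x(e_x - e_{x-1}) + u_x e_x` equals `ρ²(y - ρ)(y - ρ⁻³)`: the growing solution
is the tangent `∂_c m ~ ρ^x` of the equilibrium family, the decaying (`ℓ²`) one decays like `ρ^{-3x}`,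
the exact reciprocal of the growth `ρ^{3x}` of the static bond force `V'(Δm_x) ~ β Δm_x³`.
[folklore] -/
theorem stretchedTransfer_charpoly_eq (ρ y : ℝ) (hρ : ρ ≠ 0) :
    ρ ^ 2 * y ^ 2 - (ρ ^ 2 + 1 + ρ ^ 2 * (ρ - 1) * (1 - ρ⁻¹ ^ 3)) * y + 1 =
      ρ ^ 2 * (y - ρ) * (y - ρ⁻¹ ^ 3) := by
  field_simp
  ring

/-- Hence the two asymptotic ratios are exactly `ρ` and `ρ⁻³`, whose product with the bond-force
growth `ρ³` per site is `1`: the anchored linear response does not decay against the static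
prefactor (module docstring, item 3(iii)). [folklore] -/
theorem stretchedTransfer_ratios (ρ : ℝ) (hρ : ρ ≠ 0) (y : ℝ) :
    ρ ^ 2 * y ^ 2 - (ρ ^ 2 + 1 + ρ ^ 2 * (ρ - 1) * (1 - ρ⁻¹ ^ 3)) * y + 1 = 0 ↔
      y = ρ ∨ y = ρ⁻¹ ^ 3 := by
  rw [stretchedTransfer_charpoly_eq ρ y hρ, mul_assoc, mul_eq_zero, mul_eq_zero, sub_eq_zero,
    sub_eq_zero]
  constructor
  · rintro (h | h | h)
    · exact absurd h (pow_ne_zero 2 hρ)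
    · exact Or.inl h
    · exact Or.inr h
  · rintro (h | h)
    · exact Or.inr (Or.inl h)
    · exact Or.inr (Or.inr h)

end Summit.AtomisticToContinuum.FouriersLaw.Theorems.AbelThermodynamicLimit.LoomisCompactHorizonWitness

end
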